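import Mathlib
import Summits.MatrixMultiplication.MatrixMultiplication.Theses.HiddenToeplitzCorners
import Literature.Computability.AlgebraicComplexity.ArithCircuitProofs
import Literature.Computability.AlgebraicComplexity.MatMulTotalComplexityProofs
import Literature.Computability.AlgebraicComplexity.FastFourierTransform
import Literature.Computability.AlgebraicComplexity.DivisionSLP
import Literature.LinearAlgebra.Matrix.CauchyDeterminant
import Literature.LinearAlgebra.Matrix.CauchyLike

/-!
# Stub `stub_evalTransfer` of crux `HiddenToeplitzCorners.ToeplitzLikeDetCost` (stmt-MatrixMultiplication-7491),
# line `Sketch`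

R → K transfer of principal minors and determinants at K = Frac ℂ[X]; Cauchy matrices are nonsingular.

* `evalTransfer_map_nonsing_inv` — a ring hom commutes with the inverse of a matrix with unit
  determinant;
* `evalTransfer_det_formula` — `det (M₁ · T · M₂⁻¹) = φ(det M₁ · (det M₂)⁻¹) · ψ(det T)` after
  mapping the constant matrices `M₁, M₂` along `φ` and `T` along `ψ` into a field;
* `evalTransfer_minor_ne_zero` — for a tower `k → R → K` with `R → K` injective and an evaluation
  `ev : R → k` retracting `k → R`, a principal minor of `M₁ · T · M₂⁻¹` that is nonzero after
  evaluation is nonzero over `K`;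
* `evalTransfer_det_cauchyMatrix_ne_zero`, `evalTransfer_det_cauchy_ne_zero` — Cauchy matrices
  `((u_i - v_j)⁻¹)` with `u`, `v` injective and `u_i ≠ v_j` are nonsingular (induction on the size with
  the recurrence `det_cauchyMatrix_succ` for Cauchy's double alternant).

Target tree file: `Summits/MatrixMultiplication/MatrixMultiplication/Theorems/HiddenToeplitzCornersToeplitzLikeDetCostEvalTransfer.lean`
(helper for the crux, landed with `--supports stmt-MatrixMultiplication-7491`). The theorem `stub_evalTransfer`
below must keep EXACTLY this name and signature (it is registered on the crux).
-/

set_option linter.dupNamespace false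

namespace Summit.MatrixMultiplication.MatrixMultiplication.Theorems

open scoped BigOperators Matrix
open Literature.Computability.AlgebraicComplexity Literature.LinearAlgebra.Matrix
open Literature.Computability.AlgebraicComplexity.ArithCircuit (FanInTwoSeq freeInputs)
open Summit.MatrixMultiplication.MatrixMultiplication.Theses.HiddenToeplitzCorners (ToeplitzLikeDetCost)

noncomputable section

/-- A ring homomorphism commutes with the (nonsingular) inverse of a matrix whose determinant is a
unit: `(A⁻¹).map f = (A.map f)⁻¹`. [folklore] -/
theorem evalTransfer_map_nonsing_inv {m S T : Type*} [Fintype m] [DecidableEq m] [CommRing S]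
    [CommRing T] (f : S →+* T) (A : Matrix m m S) (hA : IsUnit A.det) :
    (A⁻¹).map f = (A.map f)⁻¹ := by
  refine (Matrix.inv_eq_right_inv ?_).symm
  rw [← Matrix.map_mul, Matrix.mul_nonsing_inv _ hA, Matrix.map_one _ (map_zero f) (map_one f)]

/-- Determinant of `M₁ · T · M₂⁻¹` over a field, the constant factors `M₁, M₂` mapped along `φ` and
the middle factor along `ψ`: `det = φ (det M₁ · (det M₂)⁻¹) · ψ (det T)`. [folklore] -/
theorem evalTransfer_det_formula {m k R K : Type*} [Fintype m] [DecidableEq m] [Field k]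
    [CommRing R] [Field K] (φ : k →+* K) (ψ : R →+* K) (TR : Matrix m m R)
    (M₁ M₂ : Matrix m m k) :
    (M₁.map φ * TR.map ψ * (M₂.map φ)⁻¹).det = φ (M₁.det * (M₂.det)⁻¹) * ψ TR.det := by
  have h1 : (M₁.map φ).det = φ M₁.det := by
    rw [← RingHom.mapMatrix_apply, ← RingHom.map_det]
  have h2 : (M₂.map φ).det = φ M₂.det := by
    rw [← RingHom.mapMatrix_apply, ← RingHom.map_det]
  have h3 : (TR.map ψ).det = ψ TR.det := by
    rw [← RingHom.mapMatrix_apply, ← RingHom.map_det]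
  rw [Matrix.det_mul, Matrix.det_mul, Matrix.det_nonsing_inv, Ring.inverse_eq_inv, h1, h2, h3,
    map_mul, map_inv₀]
  ring

/-- Transfer of nonvanishing principal minors along a tower `k → R → K` (`R → K` injective) with
an evaluation `ev : R → k` retracting `k → R`: if the minor of `M₁ · ev(T) · M₂⁻¹` on rows and
columns `g` is nonzero, then so is the corresponding minor of `M₁ · T · M₂⁻¹` read in `K`
(ring homomorphisms commute with determinants, products and inverses). [folklore] -/
theorem evalTransfer_minor_ne_zero {m ι k R K : Type*} [Fintype m] [DecidableEq m] [Fintype ι]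
    [DecidableEq ι] [Field k] [CommRing R] [Field K] [Algebra k R] [Algebra R K] [Algebra k K]
    [IsScalarTower k R K] (hinj : Function.Injective (algebraMap R K)) (ev : R →+* k)
    (hev : ∀ a, ev (algebraMap k R a) = a) (TR : Matrix m m R) (M₁ M₂ : Matrix m m k)
    (hM₂ : IsUnit M₂.det) (g : ι → m)
    (h : ((M₁ * TR.map ev * M₂⁻¹).submatrix g g).det ≠ 0) :
    ((M₁.map (algebraMap k K) * TR.map (algebraMap R K) *
        (M₂.map (algebraMap k K))⁻¹).submatrix g g).det ≠ 0 := by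
  set CR : Matrix m m R := M₁.map (algebraMap k R) * TR * (M₂.map (algebraMap k R))⁻¹ with hCR
  have hc2 : IsUnit (M₂.map (algebraMap k R)).det := by
    rw [← RingHom.mapMatrix_apply, ← RingHom.map_det]
    exact hM₂.map _
  have htower : (algebraMap k K : k → K) = (algebraMap R K) ∘ (algebraMap k R) := by
    funext a
    exact IsScalarTower.algebraMap_apply k R K a
  have hK : M₁.map (algebraMap k K) * TR.map (algebraMap R K) * (M₂.map (algebraMap k K))⁻¹ =
      CR.map (algebraMap R K) := by
    rw [htower, ← Matrix.map_map, ← Matrix.map_map, ← evalTransfer_map_nonsing_inv _ _ hc2, hCR,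
      Matrix.map_mul, Matrix.map_mul]
  have hev' : (ev : R → k) ∘ (algebraMap k R) = id := funext hev
  have h0 : CR.map ev = M₁ * TR.map ev * M₂⁻¹ := by
    rw [hCR, Matrix.map_mul, Matrix.map_mul, evalTransfer_map_nonsing_inv _ _ hc2]
    simp only [Matrix.map_map, hev', Matrix.map_id]
  rw [hK, Matrix.submatrix_map]
  intro hdet
  apply h
  have hR : (CR.submatrix g g).det = 0 := by
    refine hinj ?_
    rw [map_zero, RingHom.map_det, RingHom.mapMatrix_apply, hdet]
  rw [← h0, Matrix.submatrix_map, ← RingHom.mapMatrix_apply, ← RingHom.map_det, hR, map_zero]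

/-- All leading truncations of a Cauchy matrix `((x_i - y_j)⁻¹)` built from sequences that are
injective and mutually avoiding below `m` are nonsingular (induction with the recurrence for
Cauchy's double alternant). [folklore] -/
theorem evalTransfer_det_cauchyMatrix_ne_zero {K : Type*} [Field K] (x y : ℕ → K) (m : ℕ)
    (hxy : ∀ i j : ℕ, i < m → j < m → x i ≠ y j)
    (hx : ∀ i j : ℕ, i < m → j < m → x i = x j → i = j)
    (hy : ∀ i j : ℕ, i < m → j < m → y i = y j → i = j) :
    ∀ k, k ≤ m → (cauchyMatrix x y k).det ≠ 0 := by
  intro k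
  induction k with
  | zero =>
    intro _
    rw [det_cauchyMatrix_zero]
    exact one_ne_zero
  | succ k ih =>
    intro hk
    rw [det_cauchyMatrix_succ x y k (fun i j hi hj => hxy i j (by omega) (by omega))]
    refine mul_ne_zero (div_ne_zero ?_ ?_) (ih (by omega))
    · refine Finset.prod_ne_zero_iff.2 fun i hi => ?_
      have hi' := Finset.mem_range.1 hi
      refine mul_ne_zero (sub_ne_zero.2 fun h => ?_) (sub_ne_zero.2 fun h => ?_)
      · have := hx k i (by omega) (by omega) h
        omega
      · have := hy i k (by omega) (by omega) h
        omega
    · refine mul_ne_zero (sub_ne_zero.2 (hxy k k (by omega) (by omega))) ?_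
      refine Finset.prod_ne_zero_iff.2 fun i hi => ?_
      have hi' := Finset.mem_range.1 hi
      exact mul_ne_zero (sub_ne_zero.2 (hxy k i (by omega) (by omega)))
        (sub_ne_zero.2 (hxy i k (by omega) (by omega)))

/-- **Cauchy matrices are nonsingular**: if `u, v : ι → K` are injective and `u i ≠ v j` for all
`i, j`, then `det ((u_i - v_j)⁻¹)_{i,j} ≠ 0`. [folklore] -/
theorem evalTransfer_det_cauchy_ne_zero {K : Type*} [Field K] (ι : Type*) [Fintype ι]
    [DecidableEq ι] (u v : ι → K) (hu : Function.Injective u) (hv : Function.Injective v)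
    (huv : ∀ i j, u i ≠ v j) : (Matrix.of fun i j : ι => (u i - v j)⁻¹).det ≠ 0 := by
  obtain ⟨m, hm⟩ : ∃ m, Fintype.card ι = m := ⟨_, rfl⟩
  let e : ι ≃ Fin m := (Fintype.equivFin ι).trans (finCongr hm)
  let x : ℕ → K := fun k => if h : k < m then u (e.symm ⟨k, h⟩) else 0
  let y : ℕ → K := fun k => if h : k < m then v (e.symm ⟨k, h⟩) else 0
  have hx' : ∀ (k : ℕ) (hk : k < m), x k = u (e.symm ⟨k, hk⟩) := fun k hk => by
    simp only [x, dif_pos hk]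
  have hy' : ∀ (k : ℕ) (hk : k < m), y k = v (e.symm ⟨k, hk⟩) := fun k hk => by
    simp only [y, dif_pos hk]
  have hA : (Matrix.of fun i j : ι => (u i - v j)⁻¹) = (cauchyMatrix x y m).submatrix e e := by
    ext i j
    rw [Matrix.submatrix_apply, cauchyMatrix_apply, Matrix.of_apply, hx' _ (e i).isLt,
      hy' _ (e j).isLt, Fin.eta, Fin.eta, Equiv.symm_apply_apply, Equiv.symm_apply_apply]
  rw [hA, Matrix.det_submatrix_equiv_self]
  refine evalTransfer_det_cauchyMatrix_ne_zero x y m ?_ ?_ ?_ m le_rfl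
  · intro i j hi hj
    rw [hx' i hi, hy' j hj]
    exact huv _ _
  · intro i j hi hj h
    rw [hx' i hi, hx' j hj] at h
    exact Fin.mk.inj_iff.mp (e.symm.injective (hu h))
  · intro i j hi hj h
    rw [hy' i hi, hy' j hj] at h
    exact Fin.mk.inj_iff.mp (e.symm.injective (hv h))

/-- **Stub `evalTransfer`** — see `Lines/Sketch.lean`. [folklore] -/
theorem stub_evalTransfer :
    (∀ (σ : Type) [DecidableEq σ] (n : ℕ) (x0 : σ → ℂ) (TR : Matrix (Fin n) (Fin n) (MvPolynomial σ ℂ))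
        (M₁ M₂ : Matrix (Fin n) (Fin n) ℂ), IsUnit M₂.det →
        (∀ (ι : Type) [Fintype ι] [DecidableEq ι] (g : ι → Fin n),
          ((M₁ * TR.map (MvPolynomial.eval x0) * M₂⁻¹).submatrix g g).det ≠ 0 →
          ((M₁.map (algebraMap ℂ (FractionRing (MvPolynomial σ ℂ))) *
              TR.map (algebraMap (MvPolynomial σ ℂ) (FractionRing (MvPolynomial σ ℂ))) *
              (M₂.map (algebraMap ℂ (FractionRing (MvPolynomial σ ℂ))))⁻¹).submatrix g g).det ≠ 0) ∧
        (M₁.map (algebraMap ℂ (FractionRing (MvPolynomial σ ℂ))) *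
            TR.map (algebraMap (MvPolynomial σ ℂ) (FractionRing (MvPolynomial σ ℂ))) *
            (M₂.map (algebraMap ℂ (FractionRing (MvPolynomial σ ℂ))))⁻¹).det =
          algebraMap ℂ (FractionRing (MvPolynomial σ ℂ)) (M₁.det * (M₂.det)⁻¹) *
            algebraMap (MvPolynomial σ ℂ) (FractionRing (MvPolynomial σ ℂ)) TR.det) ∧
    (∀ (ι : Type) [Fintype ι] [DecidableEq ι] (u v : ι → ℂ), Function.Injective u → Function.Injective v →
        (∀ i j, u i ≠ v j) → (Matrix.of fun i j : ι => (u i - v j)⁻¹).det ≠ 0) := by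
  refine ⟨fun σ _ n x0 TR M₁ M₂ hM₂ => ⟨fun ι _ _ g h => ?_, ?_⟩,
    fun ι _ _ u v hu hv huv => evalTransfer_det_cauchy_ne_zero ι u v hu hv huv⟩
  · exact evalTransfer_minor_ne_zero (IsFractionRing.injective _ _) (MvPolynomial.eval x0)
      (fun a => by rw [MvPolynomial.algebraMap_eq, MvPolynomial.eval_C]) TR M₁ M₂ hM₂ g h
  · exact evalTransfer_det_formula _ _ TR M₁ M₂

end

end Summit.MatrixMultiplication.MatrixMultiplication.Theorems
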